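import Summits.NavierStokesRegularity.NavierStokesRegularity.Theorems.CircuitTrace.Negative.Structure

/-!
# `PerpetualPump.CircuitTrace` (crux stmt-NavierStokesRegularity-1836), line `tilted-trace-gronwall`:
# stub S2a `stub_blockStaysQuiet` — the block above a quiet valve stays quiet

First maximum principle for Tao's viscous circuit system (`circuitRHS`, `α = 2/5`) in critical units
`a_{i,n}(t) = lam^{n/5} |X_{i,n}(t)|`: there is `δ₁ = δ₁(m, coeff) > 0` such that for `0 < δ ≤ δ₁`,
if the valve scale `n ≥ 0` is `δ`-quiet on `[t₁, T)` and every mode strictly above `n` is `δ`-quiet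
at time `t₁`, then every mode strictly above `n` stays `2δ`-quiet on `[t₁, T)`.

Proof: first-touch argument. If some block amplitude exceeds `2δ` at a time `t₀`, let `τ` be the
infimum of the bad times in `[t₁, t₀]`; only finitely many modes can be bad (the a-priori `H¹⁰`
bound on `[0, t₀]` kills all scales above some `J`), so by continuity some mode `(i*, j*)`, `j* > n`,
touches `2δ` at `τ > t₁` from below while every amplitude at the scales `≥ n` is `≤ 2δ` at `τ`.
Every quadratic monomial driving scale `j*` is then `≤ K lam^{3j*/5} (2δ)²` in size, so
`d/dt X_{i*,j*}² ≤ 2 lam^{3j*/5} |X| (16 K m² δ² - 2δ) < 0` at `τ` once `16 K m² δ ≤ 1`,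
contradicting the first touch from below. [folklore]
-/

noncomputable section

set_option linter.dupNamespace false

namespace Summit.NavierStokesRegularity.NavierStokesRegularity.Theorems.PerpetualPumpCircuitTrace

open Finset Real Set Filter Topology
open Summit.NavierStokesRegularity.NavierStokesRegularity.Theorems.CircuitTrace.Negative

/-- One quadratic monomial `c · lam^e · x · y` in critical units: if `lam^p |x| ≤ B`,
`lam^q |y| ≤ B`, `|c| ≤ K` and `e - p - q ≤ E` (`lam ≥ 1`), then it is `≤ K lam^E B²` in size.
[folklore] -/
theorem blockStaysQuiet_term_bound {lam K B c e p q x y E : ℝ} (hlam : 1 ≤ lam) (hK : |c| ≤ K)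
    (hB : 0 ≤ B) (hx : lam ^ p * |x| ≤ B) (hy : lam ^ q * |y| ≤ B) (hE : e - p - q ≤ E) :
    |c * lam ^ e * x * y| ≤ K * lam ^ E * B * B := by
  have hlam0 : 0 < lam := by linarith
  have hsplit : lam ^ e = lam ^ (e - p - q) * lam ^ p * lam ^ q := by
    rw [← Real.rpow_add hlam0, ← Real.rpow_add hlam0]; ring_nf
  have hK0 : 0 ≤ K := (abs_nonneg c).trans hK
  have hle : lam ^ (e - p - q) ≤ lam ^ E := Real.rpow_le_rpow_of_exponent_le hlam hE
  have hE0 : 0 ≤ lam ^ E := (Real.rpow_pos_of_pos hlam0 _).le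
  have h0 : 0 ≤ lam ^ (e - p - q) := (Real.rpow_pos_of_pos hlam0 _).le
  have h1' : 0 ≤ lam ^ p * |x| := mul_nonneg (Real.rpow_pos_of_pos hlam0 _).le (abs_nonneg _)
  have h2' : 0 ≤ lam ^ q * |y| := mul_nonneg (Real.rpow_pos_of_pos hlam0 _).le (abs_nonneg _)
  rw [abs_mul, abs_mul, abs_mul, abs_of_nonneg (Real.rpow_pos_of_pos hlam0 e).le, hsplit]
  have h1 : |c| * lam ^ (e - p - q) ≤ K * lam ^ E := mul_le_mul hK hle h0 hK0
  have h2 : |c| * lam ^ (e - p - q) * (lam ^ p * |x|) ≤ K * lam ^ E * B :=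
    mul_le_mul h1 hx h1' (mul_nonneg hK0 hE0)
  have h3 : |c| * lam ^ (e - p - q) * (lam ^ p * |x|) * (lam ^ q * |y|) ≤ K * lam ^ E * B * B :=
    mul_le_mul h2 hy h2' (mul_nonneg (mul_nonneg hK0 hE0) hB)
  calc |c| * (lam ^ (e - p - q) * lam ^ p * lam ^ q) * |x| * |y|
      = |c| * lam ^ (e - p - q) * (lam ^ p * |x|) * (lam ^ q * |y|) := by ring
    _ ≤ K * lam ^ E * B * B := h3

/-- The quadratic part of the circuit vector field at scale `j` in critical units: if every
amplitude at the scales `j-1, j, j+1` is `≤ B`, then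
`|F_{i,j} + lam^{4j/5} X_{i,j}| ≤ 4 m² K lam^{3j/5} B²` (offsets `(0,0,0)`, `(1,0,0)`, `(0,1,0)` cost
`lam^{3j/5}`, `lam^{3j/5 - 1/5}`, `lam^{3j/5 - 1/5}`, the source `(0,0,1)` costs `lam^{3j/5 - 3/5}`).
[folklore] -/
theorem blockStaysQuiet_quad_bound {lam : ℝ} (hlam : 1 ≤ lam) {m : ℕ}
    (coeff : Fin m → Fin m → Fin m → Option (Fin 3) → ℝ) {K : ℝ}
    (hK : ∀ i₁ i₂ i₃ μ, |coeff i₁ i₂ i₃ μ| ≤ K) (X : Fin m → ℤ → ℝ → ℝ) (i : Fin m) (j : ℤ)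
    (t : ℝ) {B : ℝ} (hB : 0 ≤ B)
    (hamp : ∀ (i' : Fin m) (k : ℤ), j - 1 ≤ k → k ≤ j + 1 →
      lam ^ ((1 / 5 : ℝ) * k) * |X i' k t| ≤ B) :
    |circuitRHS lam coeff X i j t + lam ^ ((4 / 5 : ℝ) * j) * X i j t|
      ≤ 4 * (m : ℝ) ^ 2 * K * lam ^ ((3 / 5 : ℝ) * j) * B ^ 2 := by
  have hquad : circuitRHS lam coeff X i j t + lam ^ ((4 / 5 : ℝ) * j) * X i j t =
      ∑ i₁ : Fin m, ∑ i₂ : Fin m, ∑ μ : Option (Fin 3),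
        coeff i₁ i₂ i μ * lam ^ ((j : ℝ) - (if μ = some 2 then 1 else 0)) *
          X i₁ (j + ((if μ = some 0 then 1 else 0) - (if μ = some 2 then 1 else 0))) t *
          X i₂ (j + ((if μ = some 1 then 1 else 0) - (if μ = some 2 then 1 else 0))) t := by
    unfold circuitRHS; ring
  rw [hquad]
  have hterm : ∀ (i₁ i₂ : Fin m) (μ : Option (Fin 3)),
      |coeff i₁ i₂ i μ * lam ^ ((j : ℝ) - (if μ = some 2 then 1 else 0)) *
        X i₁ (j + ((if μ = some 0 then 1 else 0) - (if μ = some 2 then 1 else 0))) t *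
        X i₂ (j + ((if μ = some 1 then 1 else 0) - (if μ = some 2 then 1 else 0))) t|
        ≤ K * lam ^ ((3 / 5 : ℝ) * j) * B * B := by
    intro i₁ i₂ μ
    have hc := hK i₁ i₂ i μ
    rcases μ with _ | a
    · simp only [reduceCtorEq, ite_false, sub_zero, add_zero]
      exact blockStaysQuiet_term_bound hlam hc hB (hamp i₁ j (by linarith) (by linarith))
        (hamp i₂ j (by linarith) (by linarith)) (by linarith)
    · fin_cases a
      · simp only [Fin.zero_eta, Fin.isValue, Option.some.injEq, Fin.reduceEq, ite_false,
          sub_zero, ite_true, add_zero]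
        exact blockStaysQuiet_term_bound hlam hc hB (hamp i₁ (j + 1) (by linarith) le_rfl)
          (hamp i₂ j (by linarith) (by linarith)) (by push_cast; linarith)
      · simp only [Fin.mk_one, Fin.isValue, Option.some.injEq, Fin.reduceEq, ite_false,
          sub_zero, add_zero, ite_true]
        exact blockStaysQuiet_term_bound hlam hc hB (hamp i₁ j (by linarith) (by linarith))
          (hamp i₂ (j + 1) (by linarith) le_rfl) (by push_cast; linarith)
      · simp only [Fin.reduceFinMk, Fin.isValue, ite_true, Option.some.injEq, Fin.reduceEq,
          ite_false, zero_sub]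
        exact blockStaysQuiet_term_bound hlam hc hB (hamp i₁ (j + -1) (by linarith) (by linarith))
          (hamp i₂ (j + -1) (by linarith) (by linarith)) (by push_cast; linarith)
  refine (Finset.abs_sum_le_sum_abs _ _).trans ?_
  refine (Finset.sum_le_sum fun i₁ _ => Finset.abs_sum_le_sum_abs _ _).trans ?_
  refine (Finset.sum_le_sum fun i₁ _ => Finset.sum_le_sum fun i₂ _ =>
    Finset.abs_sum_le_sum_abs _ _).trans ?_
  refine (Finset.sum_le_sum fun i₁ _ => Finset.sum_le_sum fun i₂ _ =>
    Finset.sum_le_sum fun μ _ => hterm i₁ i₂ μ).trans ?_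
  simp only [Finset.sum_const, Finset.card_univ, Fintype.card_option, Fintype.card_fin,
    nsmul_eq_mul]
  push_cast
  exact le_of_eq (by ring)

/-- **Sign at a first touch.** If every amplitude at the scales `j-1, j, j+1` is `≤ 2δ` while
`a_{i,j} = 2δ` exactly, and `16 K m² δ ≤ 1`, then `d/dt X_{i,j}² = 2 X_{i,j} F_{i,j} < 0`:
the dissipation `-2 lam^{4j/5} X² = -2 lam^{3j/5}|X| · 2δ` beats the quadratic forcing
`≤ 2|X| · 16 K m² δ² lam^{3j/5}`. [folklore] -/
theorem blockStaysQuiet_deriv_neg {lam : ℝ} (hlam : 1 ≤ lam) {m : ℕ}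
    (coeff : Fin m → Fin m → Fin m → Option (Fin 3) → ℝ) {K : ℝ}
    (hK : ∀ i₁ i₂ i₃ μ, |coeff i₁ i₂ i₃ μ| ≤ K)
    (X : Fin m → ℤ → ℝ → ℝ) (i : Fin m) (j : ℤ) (t : ℝ) {δ : ℝ} (hδ : 0 < δ)
    (hsmall : 16 * K * (m : ℝ) ^ 2 * δ ≤ 1)
    (hamp : ∀ (i' : Fin m) (k : ℤ), j - 1 ≤ k → k ≤ j + 1 →
      lam ^ ((1 / 5 : ℝ) * k) * |X i' k t| ≤ 2 * δ)
    (heq : lam ^ ((1 / 5 : ℝ) * j) * |X i j t| = 2 * δ) :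
    2 * X i j t * circuitRHS lam coeff X i j t < 0 := by
  have hlam0 : 0 < lam := by linarith
  have hQb : |circuitRHS lam coeff X i j t + lam ^ ((4 / 5 : ℝ) * j) * X i j t|
      ≤ 4 * (m : ℝ) ^ 2 * K * lam ^ ((3 / 5 : ℝ) * j) * (2 * δ) ^ 2 :=
    blockStaysQuiet_quad_bound hlam coeff hK X i j t (by linarith) hamp
  have h45 : lam ^ ((4 / 5 : ℝ) * j) = lam ^ ((3 / 5 : ℝ) * j) * lam ^ ((1 / 5 : ℝ) * j) := by
    rw [← Real.rpow_add hlam0]; ring_nf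
  have hXpos : 0 < |X i j t| := by
    by_contra h
    have h0 : |X i j t| = 0 := le_antisymm (not_lt.mp h) (abs_nonneg _)
    rw [h0, mul_zero] at heq
    linarith
  have h3pos : 0 < lam ^ ((3 / 5 : ℝ) * j) := Real.rpow_pos_of_pos hlam0 _
  have hsq : lam ^ ((4 / 5 : ℝ) * j) * (X i j t * X i j t)
      = lam ^ ((3 / 5 : ℝ) * j) * |X i j t| * (2 * δ) := by
    rw [h45, ← heq, ← abs_mul_abs_self (X i j t)]; ring
  have hXQ : X i j t * (circuitRHS lam coeff X i j t + lam ^ ((4 / 5 : ℝ) * j) * X i j t)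
      ≤ |X i j t| * (4 * (m : ℝ) ^ 2 * K * lam ^ ((3 / 5 : ℝ) * j) * (2 * δ) ^ 2) :=
    calc X i j t * (circuitRHS lam coeff X i j t + lam ^ ((4 / 5 : ℝ) * j) * X i j t)
        ≤ |X i j t * (circuitRHS lam coeff X i j t + lam ^ ((4 / 5 : ℝ) * j) * X i j t)| :=
          le_abs_self _
      _ = |X i j t| * |circuitRHS lam coeff X i j t + lam ^ ((4 / 5 : ℝ) * j) * X i j t| :=
          abs_mul _ _
      _ ≤ |X i j t| * (4 * (m : ℝ) ^ 2 * K * lam ^ ((3 / 5 : ℝ) * j) * (2 * δ) ^ 2) :=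
          mul_le_mul_of_nonneg_left hQb (abs_nonneg _)
  have hpos : 0 < 2 * (lam ^ ((3 / 5 : ℝ) * j) * |X i j t|) := by positivity
  have hneg : (16 * K * (m : ℝ) ^ 2 * δ) * δ - 2 * δ < 0 := by nlinarith
  calc 2 * X i j t * circuitRHS lam coeff X i j t
      = -2 * (lam ^ ((4 / 5 : ℝ) * j) * (X i j t * X i j t))
        + 2 * (X i j t * (circuitRHS lam coeff X i j t + lam ^ ((4 / 5 : ℝ) * j) * X i j t)) := by
        ring
    _ ≤ -2 * (lam ^ ((3 / 5 : ℝ) * j) * |X i j t| * (2 * δ))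
        + 2 * (|X i j t| * (4 * (m : ℝ) ^ 2 * K * lam ^ ((3 / 5 : ℝ) * j) * (2 * δ) ^ 2)) := by
        rw [hsq]; linarith
    _ = 2 * (lam ^ ((3 / 5 : ℝ) * j) * |X i j t|) * ((16 * K * (m : ℝ) ^ 2 * δ) * δ - 2 * δ) := by
        ring
    _ < 0 := mul_neg_of_pos_of_neg hpos hneg

/-- Above some scale `J` an `H¹⁰`-type bound `lam^{4n}|X_{i,n}| ≤ C` on a set of times makes every
critical amplitude `lam^{j/5}|X_{i,j}|`, `j > J`, at most `δ` there (`lam > 1`). [folklore] -/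
theorem blockStaysQuiet_tail {lam : ℝ} (hlam : 1 < lam) {m : ℕ} (X : Fin m → ℤ → ℝ → ℝ)
    {C δ : ℝ} (hδ : 0 < δ) {S : Set ℝ}
    (hC : ∀ (i : Fin m) (n : ℤ), ∀ t ∈ S, lam ^ ((4 : ℝ) * n) * |X i n t| ≤ C) :
    ∃ J : ℤ, ∀ (i : Fin m) (j : ℤ), J < j → ∀ t ∈ S, lam ^ ((1 / 5 : ℝ) * j) * |X i j t| ≤ δ := by
  have hlam0 : 0 < lam := by linarith
  obtain ⟨N, hN⟩ := pow_unbounded_of_one_lt (max C 0 / δ) hlam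
  refine ⟨N, fun i j hj t ht => ?_⟩
  have hjR : (N : ℝ) + 1 ≤ j := by
    have h1 : (N : ℤ) + 1 ≤ j := Int.lt_iff_add_one_le.mp hj
    exact_mod_cast h1
  have hN0 : (0 : ℝ) ≤ N := Nat.cast_nonneg N
  have hsplit : lam ^ ((1 / 5 : ℝ) * j) * |X i j t|
      = (lam ^ ((19 / 5 : ℝ) * j))⁻¹ * (lam ^ ((4 : ℝ) * j) * |X i j t|) := by
    rw [← Real.rpow_neg hlam0.le, ← mul_assoc, ← Real.rpow_add hlam0]; ring_nf
  rw [hsplit]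
  have hbig : lam ^ N ≤ lam ^ ((19 / 5 : ℝ) * j) := by
    rw [← Real.rpow_natCast]
    exact Real.rpow_le_rpow_of_exponent_le hlam.le (by linarith)
  have hpowpos : 0 < lam ^ ((19 / 5 : ℝ) * j) := Real.rpow_pos_of_pos hlam0 _
  have hle : lam ^ ((4 : ℝ) * j) * |X i j t| ≤ max C 0 := (hC i j t ht).trans (le_max_left _ _)
  have hlt : max C 0 / δ < lam ^ ((19 / 5 : ℝ) * j) := hN.trans_le hbig
  rw [div_lt_iff₀ hδ] at hlt
  calc (lam ^ ((19 / 5 : ℝ) * j))⁻¹ * (lam ^ ((4 : ℝ) * j) * |X i j t|)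
      ≤ (lam ^ ((19 / 5 : ℝ) * j))⁻¹ * max C 0 :=
        mul_le_mul_of_nonneg_left hle (inv_nonneg.mpr hpowpos.le)
    _ ≤ δ := by
        rw [inv_mul_le_iff₀ hpowpos]
        linarith

/-- **S2a: the block above a quiet valve stays quiet (first maximum principle).** There is
`δ₁ = δ₁(m, coeff) > 0` (namely `16 K m² δ₁ ≤ 1`, `K = max |coeff|`) such that for `0 < δ ≤ δ₁`,
in every solution of the crux's class: if the valve scale `n ≥ 0` is `δ`-quiet on `[t₁, T)` and
every mode strictly above `n` is `δ`-quiet at `t₁ ∈ (0, T)`, then every mode strictly above `n`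
is `2δ`-quiet on `[t₁, T)`. -/
theorem stub_blockStaysQuiet :
    ∀ lam : ℝ, 1 < lam → ∀ (m : ℕ) (coeff : Fin m → Fin m → Fin m → Option (Fin 3) → ℝ) (A : ℝ),
    ∃ δ₁ : ℝ, 0 < δ₁ ∧ ∀ δ : ℝ, 0 < δ → δ ≤ δ₁ →
    ∀ (T : ℝ) (X : Fin m → ℤ → ℝ → ℝ), 0 < T →
    (∀ (i : Fin m) (n : ℤ), ∀ t ∈ Set.Ioo 0 T, HasDerivAt (X i n) (circuitRHS lam coeff X i n t) t) →
    (∀ (i : Fin m) (n : ℤ) (t : ℝ), n < 0 → X i n t = 0) →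
    (∀ T' ∈ Set.Ioo 0 T, ∃ C : ℝ, ∀ (i : Fin m) (n : ℤ), ∀ t ∈ Set.Icc 0 T',
      lam ^ ((4 : ℝ) * n) * |X i n t| ≤ C) →
    (∀ t ∈ Set.Ico 0 T, ∀ (i : Fin m) (n : ℤ), lam ^ ((1 / 5 : ℝ) * n) * |X i n t| ≤ A) →
    ∀ n : ℤ, 0 ≤ n → ∀ t₁ ∈ Set.Ioo 0 T,
    (∀ i : Fin m, ∀ t ∈ Set.Ico t₁ T, lam ^ ((1 / 5 : ℝ) * n) * |X i n t| ≤ δ) →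
    (∀ (i : Fin m) (j : ℤ), n < j → lam ^ ((1 / 5 : ℝ) * j) * |X i j t₁| ≤ δ) →
    ∀ (i : Fin m) (j : ℤ), n < j → ∀ t ∈ Set.Ico t₁ T, lam ^ ((1 / 5 : ℝ) * j) * |X i j t| ≤ 2 * δ := by
  intro lam hlam m coeff A
  obtain ⟨K, hK0, hK⟩ := exists_coeff_bound coeff
  refine ⟨1 / (16 * K * (m : ℝ) ^ 2 + 1), by positivity, ?_⟩
  intro δ hδ hδ₁ T X _hT hderiv _hcut hapr _hA n _hn t₁ ht₁ hvalve hblock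
  have hlam1 : (1 : ℝ) ≤ lam := hlam.le
  have hlam0 : 0 < lam := by linarith
  -- smallness of `δ`
  have hsmall : 16 * K * (m : ℝ) ^ 2 * δ ≤ 1 := by
    have h16 : 0 ≤ 16 * K * (m : ℝ) ^ 2 := by positivity
    calc 16 * K * (m : ℝ) ^ 2 * δ ≤ 16 * K * (m : ℝ) ^ 2 * (1 / (16 * K * (m : ℝ) ^ 2 + 1)) :=
          mul_le_mul_of_nonneg_left hδ₁ h16
      _ ≤ 1 := by
          rw [mul_one_div, div_le_one (by positivity)]
          linarith
  by_contra hcon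
  push Not at hcon
  obtain ⟨i₀, j₀, hj₀, t₀, ht₀, hbad₀⟩ := hcon
  have ht₀T : t₀ < T := ht₀.2
  have ht₁0 : 0 < t₁ := ht₁.1
  have ht₀0 : 0 < t₀ := lt_of_lt_of_le ht₁0 ht₀.1
  -- (1) finitely many candidates: the a-priori bound on `[0, t₀]` kills the scales above `J`
  obtain ⟨C, hC⟩ := hapr t₀ ⟨ht₀0, ht₀T⟩
  obtain ⟨J, hJ⟩ := blockStaysQuiet_tail hlam X hδ (S := Set.Icc 0 t₀) hC
  -- continuity of the amplitudes on `[t₁, t₀] ⊆ (0, T)`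
  have hcont : ∀ (i : Fin m) (j : ℤ), ∀ t ∈ Set.Icc t₁ t₀,
      ContinuousAt (fun s => lam ^ ((1 / 5 : ℝ) * j) * |X i j s|) t := by
    intro i j t ht
    have hd := hderiv i j t ⟨lt_of_lt_of_le ht₁0 ht.1, lt_of_le_of_lt ht.2 ht₀T⟩
    exact continuousAt_const.mul hd.continuousAt.abs
  -- (2) the first touch
  set Bad : Set ℝ := {t | t₁ ≤ t ∧ t ≤ t₀ ∧
    ∃ (i : Fin m) (j : ℤ), n < j ∧ 2 * δ ≤ lam ^ ((1 / 5 : ℝ) * j) * |X i j t|} with hBad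
  have ht₀Bad : t₀ ∈ Bad := ⟨ht₀.1, le_rfl, i₀, j₀, hj₀, hbad₀.le⟩
  have hne : Bad.Nonempty := ⟨t₀, ht₀Bad⟩
  have hbdd : BddBelow Bad := ⟨t₁, fun t ht => ht.1⟩
  set τ := sInf Bad with hτ
  have hτ₁ : t₁ ≤ τ := le_csInf hne fun t ht => ht.1
  have hτ₀ : τ ≤ t₀ := csInf_le hbdd ht₀Bad
  have hτT : τ < T := lt_of_le_of_lt hτ₀ ht₀T
  -- strictly before `τ` everything above the valve is `< 2δ`
  have hquiet : ∀ t, t₁ ≤ t → t < τ → ∀ (i : Fin m) (j : ℤ), n < j →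
      lam ^ ((1 / 5 : ℝ) * j) * |X i j t| < 2 * δ := by
    intro t ht1 htτ i j hj
    by_contra h
    have htB : t ∈ Bad := ⟨ht1, htτ.le.trans hτ₀, i, j, hj, not_lt.mp h⟩
    exact absurd (csInf_le hbdd htB) (not_le.mpr htτ)
  -- `τ` itself is bad (continuity of the finitely many candidate amplitudes)
  have hτBad : ∃ (i : Fin m) (j : ℤ), n < j ∧ 2 * δ ≤ lam ^ ((1 / 5 : ℝ) * j) * |X i j τ| := by
    by_contra hP
    push Not at hP
    have hev : ∀ᶠ s in 𝓝 τ, ∀ i : Fin m, ∀ j ∈ Finset.Ioc n J,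
        lam ^ ((1 / 5 : ℝ) * j) * |X i j s| < 2 * δ := by
      refine Filter.eventually_all.2 fun i => (Filter.eventually_all_finset _).2 fun j hj => ?_
      exact (hcont i j τ ⟨hτ₁, hτ₀⟩).eventually_lt_const (hP i j (Finset.mem_Ioc.mp hj).1)
    obtain ⟨η, hη, hηP⟩ := Metric.eventually_nhds_iff.mp hev
    have hkey : τ + η ≤ τ := by
      refine le_csInf hne fun b hb => ?_
      by_contra hlt
      push Not at hlt
      obtain ⟨hb1, hb0, i, j, hj, hij⟩ := hb
      have hτb : τ ≤ b := csInf_le hbdd ⟨hb1, hb0, i, j, hj, hij⟩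
      have hdist : dist b τ < η := by
        rw [Real.dist_eq, abs_of_nonneg (by linarith)]
        linarith
      by_cases hjJ : j ≤ J
      · have := hηP hdist i j (Finset.mem_Ioc.mpr ⟨hj, hjJ⟩)
        linarith
      · have := hJ i j (not_le.mp hjJ) b ⟨by linarith, hb0⟩
        linarith
    linarith
  obtain ⟨iS, jS, hjS, hge⟩ := hτBad
  -- hence `τ > t₁`
  have hτ₁' : t₁ < τ := by
    rcases eq_or_lt_of_le hτ₁ with h | h
    · have hb := hblock iS jS hjS
      rw [h] at hb
      linarith
    · exact h
  -- left limits: at `τ` every mode above the valve is `≤ 2δ`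
  have hle2 : ∀ (i : Fin m) (j : ℤ), n < j → lam ^ ((1 / 5 : ℝ) * j) * |X i j τ| ≤ 2 * δ := by
    intro i j hj
    have htend : Tendsto (fun s => lam ^ ((1 / 5 : ℝ) * j) * |X i j s|) (𝓝[<] τ)
        (𝓝 (lam ^ ((1 / 5 : ℝ) * j) * |X i j τ|)) :=
      (hcont i j τ ⟨hτ₁, hτ₀⟩).continuousWithinAt.tendsto
    refine le_of_tendsto htend ?_
    filter_upwards [Ioo_mem_nhdsLT hτ₁'] with s hs
    exact (hquiet s hs.1.le hs.2 i j hj).le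
  have hτIco : τ ∈ Set.Ico t₁ T := ⟨hτ₁, hτT⟩
  have hall : ∀ (i : Fin m) (k : ℤ), n ≤ k → lam ^ ((1 / 5 : ℝ) * k) * |X i k τ| ≤ 2 * δ := by
    intro i k hk
    rcases eq_or_lt_of_le hk with h | h
    · rw [← h]
      have hv := hvalve i τ hτIco
      linarith
    · exact hle2 i k h
  have heq : lam ^ ((1 / 5 : ℝ) * jS) * |X iS jS τ| = 2 * δ := le_antisymm (hle2 iS jS hjS) hge
  -- (3) the sign contradiction at `τ`
  have hneg : 2 * X iS jS τ * circuitRHS lam coeff X iS jS τ < 0 :=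
    blockStaysQuiet_deriv_neg hlam1 coeff hK X iS jS τ hδ hsmall
      (fun i' k hk1 _hk2 => hall i' k (by omega)) heq
  have hτpos : 0 < τ := lt_trans ht₁0 hτ₁'
  have hd := hderiv iS jS τ ⟨hτpos, hτT⟩
  have hf : HasDerivAt (fun s => X iS jS s * X iS jS s)
      (2 * X iS jS τ * circuitRHS lam coeff X iS jS τ) τ := by
    have h2 := hd.mul hd
    have he : circuitRHS lam coeff X iS jS τ * X iS jS τ + X iS jS τ * circuitRHS lam coeff X iS jS τ
        = 2 * X iS jS τ * circuitRHS lam coeff X iS jS τ := by ring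
    rw [he] at h2
    exact h2
  have hlim : 0 ≤ 2 * X iS jS τ * circuitRHS lam coeff X iS jS τ := by
    refine ge_of_tendsto ((hasDerivAt_iff_tendsto_slope.mp hf).mono_left (nhdsLT_le_nhdsNE τ)) ?_
    filter_upwards [Ioo_mem_nhdsLT hτ₁'] with s hs
    rw [slope_def_field]
    have hlt : lam ^ ((1 / 5 : ℝ) * jS) * |X iS jS s| < lam ^ ((1 / 5 : ℝ) * jS) * |X iS jS τ| := by
      rw [heq]; exact hquiet s hs.1.le hs.2 iS jS hjS
    have habs : |X iS jS s| < |X iS jS τ| :=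
      lt_of_mul_lt_mul_left hlt (Real.rpow_pos_of_pos hlam0 _).le
    have hsq : X iS jS s * X iS jS s < X iS jS τ * X iS jS τ := by
      have := mul_self_lt_mul_self (abs_nonneg _) habs
      rwa [abs_mul_abs_self, abs_mul_abs_self] at this
    exact div_nonneg_of_nonpos (by linarith) (by linarith [hs.2])
  linarith

end Summit.NavierStokesRegularity.NavierStokesRegularity.Theorems.PerpetualPumpCircuitTrace
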